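import Mathlib
import Summits.Ventures.PercRepro.TriangleCapFourBelowProducts

/-!
# PercRepro — THE CELL `(14, 41)`: FOUR BELOW THE DIAGONAL IS EXACT ON THE `K₄⁻`-FREE CLASS AT `a = 5`, `k = 14`
(p3, gen 39; part 136)

The one cell `a = 5` not covered by `four_below_diagonal_exact_k4m_of_five` (`k ≥ 15`): `m = 41`, `k = 14`, where
the outer count leaves the one-triangle graphs with NO outer vertex.  **`residue_of_largest`** — the generic
reduction to the triangle vertex with the largest private set.  **`one_triangle_residue_fourteen`**: `n = 11`,
`σ + C ≤ Σ_R a_y · t + 66`; `r ≥ 4` (`t ≤ 7`) by `σ ≤ 65` alone; `r = 3` (`t = 8`) is impossible — the density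
`2 Σ_R a_y + q_R = 54` with `Σ_R a_y ≤ 24`, `q_R ≤ 6` forces `q_R > 0`, an adjacent pair `y₁ ∼ y₂` in `R`, and
then `Σ_R a_y ≤ (a₁ + a₂) + 8 ≤ 16`; `r ≤ 2` is not dense.  **`four_below_diagonal_exact_k4m_fourteen_fortyone`**:
the maximum of `2·Σ_v C(d(v), 2)` over the `K₄⁻`-free graphs on `Fin 14` with `41` edges is `41 · 12 − 36 = 456`.
Axioms: standard.
-/

namespace PercRepro

namespace TriangleCap

namespace C047

open Finset

variable {V : Type*} [Fintype V] [DecidableEq V]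

/-- **THE GENERIC REDUCTION TO THE LARGEST PRIVATE SET:** a residue proved for the naming with `u`'s private set
largest holds for every naming of the triangle. -/
theorem residue_of_largest (D : SimpleGraph V) [DecidableRel D.Adj] (qmax : ℕ)
    (hyp : ∀ u v w : V, D.Adj u v → D.Adj u w → D.Adj v w →
      (∀ a b c, D.Adj a b → D.Adj a c → D.Adj b c → a = u ∨ a = v ∨ a = w) →
      degIn D ({u, v, w} : Finset V)ᶜ v ≤ degIn D ({u, v, w} : Finset V)ᶜ u →
      degIn D ({u, v, w} : Finset V)ᶜ w ≤ degIn D ({u, v, w} : Finset V)ᶜ u →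
      ((({u, v, w} : Finset V)ᶜ).filter (fun z => degIn D {u, v, w} z = 0)).card ≤ qmax →
      ∑ v, deg D v * deg D v + 4 * (Fintype.card V - 5) ≤ D.edgeFinset.card * Fintype.card V)
    {u v w : V} (huv : D.Adj u v) (huw : D.Adj u w) (hvw : D.Adj v w)
    (hT : ∀ a b c, D.Adj a b → D.Adj a c → D.Adj b c → a = u ∨ a = v ∨ a = w)
    (hq : ((({u, v, w} : Finset V)ᶜ).filter (fun z => degIn D {u, v, w} z = 0)).card ≤ qmax) :
    ∑ v, deg D v * deg D v + 4 * (Fintype.card V - 5) ≤ D.edgeFinset.card * Fintype.card V := by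
  by_cases hu : degIn D ({u, v, w} : Finset V)ᶜ v ≤ degIn D ({u, v, w} : Finset V)ᶜ u ∧
      degIn D ({u, v, w} : Finset V)ᶜ w ≤ degIn D ({u, v, w} : Finset V)ᶜ u
  · exact hyp u v w huv huw hvw hT hu.1 hu.2 hq
  by_cases hv : degIn D ({u, v, w} : Finset V)ᶜ u ≤ degIn D ({u, v, w} : Finset V)ᶜ v ∧
      degIn D ({u, v, w} : Finset V)ᶜ w ≤ degIn D ({u, v, w} : Finset V)ᶜ v
  · have hS := triple_comm_left u v w
    have hT' : ∀ a b c, D.Adj a b → D.Adj a c → D.Adj b c → a = v ∨ a = u ∨ a = w := by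
      intro a b c hab hac hbc
      rcases hT a b c hab hac hbc with h | h | h
      · exact Or.inr (Or.inl h)
      · exact Or.inl h
      · exact Or.inr (Or.inr h)
    exact hyp v u w huv.symm hvw huw hT' (by rw [hS]; exact hv.1) (by rw [hS]; exact hv.2) (by rw [hS]; exact hq)
  · have hS := triple_comm_right u v w
    have hw : degIn D ({u, v, w} : Finset V)ᶜ u ≤ degIn D ({u, v, w} : Finset V)ᶜ w ∧
        degIn D ({u, v, w} : Finset V)ᶜ v ≤ degIn D ({u, v, w} : Finset V)ᶜ w := by
      push Not at hu hv
      omega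
    have hT' : ∀ a b c, D.Adj a b → D.Adj a c → D.Adj b c → a = w ∨ a = u ∨ a = v := by
      intro a b c hab hac hbc
      rcases hT a b c hab hac hbc with h | h | h
      · exact Or.inr (Or.inl h)
      · exact Or.inr (Or.inr h)
      · exact Or.inl h
    exact hyp w u v huw.symm hvw.symm huv hT' (by rw [hS]; exact hw.1) (by rw [hS]; exact hw.2)
      (by rw [hS]; exact hq)

set_option maxHeartbeats 1000000 in
/-- **THE ONE-TRIANGLE RESIDUE AT `(14, 41)`** (`u` the triangle vertex with the largest private set, every degree
`≥ 2`, no outer vertex): `Σ_v d(v)² + 36 ≤ 41 · 14`. -/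
theorem one_triangle_residue_fourteen (D : SimpleGraph V) [DecidableRel D.Adj] (hK : K4mFree D)
    {u v w : V} (huv : D.Adj u v) (huw : D.Adj u w) (hvw : D.Adj v w)
    (hT : ∀ a b c, D.Adj a b → D.Adj a c → D.Adj b c → a = u ∨ a = v ∨ a = w) (hk : Fintype.card V = 14)
    (hdeg : ∀ z, 2 ≤ deg D z)
    (hmv : degIn D ({u, v, w} : Finset V)ᶜ v ≤ degIn D ({u, v, w} : Finset V)ᶜ u)
    (hmw : degIn D ({u, v, w} : Finset V)ᶜ w ≤ degIn D ({u, v, w} : Finset V)ᶜ u)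
    (hm : D.edgeFinset.card = 41)
    (hq : ((({u, v, w} : Finset V)ᶜ).filter (fun z => degIn D {u, v, w} z = 0)).card ≤ 0) :
    ∑ v, deg D v * deg D v + 4 * (Fintype.card V - 5) ≤ D.edgeFinset.card * Fintype.card V := by
  apply one_triangle_stability_four_of_private D hK huv huw hvw hT (by omega)
  set S : Finset V := {u, v, w} with hS
  set P : Finset V := Sᶜ.filter (fun x => D.Adj u x) with hP
  set Q : Finset V := Sᶜ.filter (fun z => degIn D S z = 0) with hQ
  clear_value S P Q
  have h3 : S.card = 3 := by rw [hS]; exact card_triple huv.ne huw.ne hvw.ne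
  have hcl : ∀ x ∈ S, ∀ y ∈ S, x ≠ y → D.Adj x y := by rw [hS]; exact clique_triple D huv huw hvw
  have hone : ∀ z ∈ Sᶜ, degIn D S z ≤ 1 := fun z hz => by
    rw [hS] at hz ⊢; exact degIn_le_one_of_triangle D hK huv huw hvw (mem_compl.mp hz)
  have hnotri : ∀ y ∈ Sᶜ, ∀ y' ∈ Sᶜ, ∀ t ∈ Sᶜ, D.Adj y y' → D.Adj y t → D.Adj y' t → False := by
    intro y hy y' _ t _ hyy' hyt _
    rw [mem_compl, hS] at hy
    simp only [mem_insert, mem_singleton, not_or] at hy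
    rcases hT y y' t hyy' hyt (by assumption) with h | h | h
    · exact hy.1 h
    · exact hy.2.1 h
    · exact hy.2.2 h
  have hPS : P ⊆ Sᶜ := by rw [hP]; exact filter_subset _ _
  have hPind : ∀ x ∈ P, ∀ x' ∈ P, ¬ D.Adj x x' := by rw [hP, hS]; exact priv_indep D hT
  have hQR : Q ⊆ Sᶜ \ P := by
    intro z hz
    rw [hQ, mem_filter] at hz
    rw [mem_sdiff, hP, mem_filter]
    refine ⟨hz.1, fun h => ?_⟩
    have : 1 ≤ degIn D S z := by
      unfold degIn
      apply card_pos.mpr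
      exact ⟨u, mem_filter.mpr ⟨by rw [hS]; exact mem_insert_self _ _, h.2.symm⟩⟩
    omega
  have hnoadjW : degIn D Sᶜ w = 0 → ∀ y ∈ (Sᶜ \ P) \ Q, ∀ y' ∈ (Sᶜ \ P) \ Q, ¬ D.Adj y y' := by
    rw [hP, hQ, hS]
    exact fun hw y hy y' hy' => not_adj_of_degIn_compl_eq_zero D hT hw hy hy'
  have hnoadjV : degIn D Sᶜ v = 0 → ∀ y ∈ (Sᶜ \ P) \ Q, ∀ y' ∈ (Sᶜ \ P) \ Q, ¬ D.Adj y y' := by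
    have hT' : ∀ a b c, D.Adj a b → D.Adj a c → D.Adj b c → a = u ∨ a = w ∨ a = v := by
      intro a b c hab hac hbc
      rcases hT a b c hab hac hbc with h | h | h
      · exact Or.inl h
      · exact Or.inr (Or.inr h)
      · exact Or.inr (Or.inl h)
    rw [hP, hQ, hS, ← triple_comm_mid u v w]
    exact fun hv y hy y' hy' => not_adj_of_degIn_compl_eq_zero D hT' hv hy hy'
  -- the numbers
  have hn : Fintype.card V = Sᶜ.card + 3 := by
    rw [card_compl, h3]
    have : S.card ≤ Fintype.card V := card_le_univ _
    rw [h3] at this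
    omega
  have ht : P.card = degIn D Sᶜ u := by rw [hP]; exact card_priv_eq D S u
  have hp := sum_private_eq D huv huw hvw
  have hσ := sigma_eq_split D huv huw hvw
  rw [← hS] at hp hσ
  have hsum_s : ∑ z ∈ Sᶜ, degIn D S z + Q.card = Sᶜ.card := by
    have hc := card_filter_add_card_filter_not (fun z => degIn D S z = 0) (s := Sᶜ)
    have h1 : ∑ z ∈ Sᶜ, degIn D S z = (Sᶜ.filter (fun z => ¬ degIn D S z = 0)).card := by
      rw [card_eq_sum_ones, sum_filter]
      apply sum_congr rfl
      intro z hz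
      have := hone z hz
      by_cases h0 : degIn D S z = 0
      · simp only [h0, not_true_eq_false, if_false]
      · simp only [h0, not_false_eq_true, if_true]; omega
    rw [hQ]
    omega
  have hcomm := sum_degIn_comm D S Sᶜ
  have hdens := two_mul_card_edges_eq_adjPairs_add D S
  have hQ6 : adjPairs D S = 6 := by
    rw [adjPairs_eq_sum_degIn]
    calc ∑ x ∈ S, degIn D S x = ∑ _x ∈ S, 2 := sum_congr rfl (fun x hx => degIn_self_of_clique D h3 hcl hx)
      _ = 6 := by rw [sum_const, h3, smul_eq_mul]
  rw [hQ6] at hdens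
  have hsplitR := sum_degIn_compl_split D S P hPS hPind
  have hRcard : (Sᶜ \ P).card + P.card = Sᶜ.card := card_sdiff_add_card_eq_card hPS
  have hYcard : ((Sᶜ \ P) \ Q).card + Q.card = (Sᶜ \ P).card := card_sdiff_add_card_eq_card hQR
  have hsR : ∑ y ∈ Sᶜ \ P, degIn D P y = ∑ y ∈ (Sᶜ \ P) \ Q, degIn D P y + ∑ z ∈ Q, degIn D P z :=
    (sum_sdiff hQR).symm
  have hsY := sum_degIn_le_card_mul D P ((Sᶜ \ P) \ Q)
  have hDout := sum_outer_degIn_split D S P Q hPS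
  have hdQ := sum_degIn_R_le D (Sᶜ \ P) Q hQR
  have houter := two_mul_card_outer_le_sum D S hdeg
  have hBC : ∑ y ∈ Sᶜ \ P, degIn D P y * degIn D P y ≤ ∑ y ∈ Sᶜ \ P, degIn D P y * P.card :=
    sum_le_sum (fun y _ => Nat.mul_le_mul_left _ (degIn_le_card D P y))
  have hBeq : ∑ y ∈ Sᶜ \ P, degIn D P y * P.card = (∑ y ∈ Sᶜ \ P, degIn D P y) * P.card := by
    rw [sum_mul]
  have hsRall := sum_degIn_le_card_mul D P (Sᶜ \ P)
  have hqRall : ∑ y ∈ Sᶜ \ P, degIn D (Sᶜ \ P) y ≤ (Sᶜ \ P).card * ((Sᶜ \ P).card - 1) :=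
    calc ∑ y ∈ Sᶜ \ P, degIn D (Sᶜ \ P) y ≤ ∑ _y ∈ Sᶜ \ P, ((Sᶜ \ P).card - 1) :=
          sum_le_sum (fun y hy => degIn_le_card_sub_one D hy)
      _ = (Sᶜ \ P).card * ((Sᶜ \ P).card - 1) := by rw [sum_const, smul_eq_mul]
  -- abbreviations
  rw [← hS, ← hP, ← hQ] at *
  rw [hBeq]
  obtain ⟨n, hn'⟩ : ∃ n, Sᶜ.card = n := ⟨_, rfl⟩
  obtain ⟨t, ht'⟩ : ∃ t, degIn D Sᶜ u = t := ⟨_, rfl⟩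
  obtain ⟨tv, htv'⟩ : ∃ tv, degIn D Sᶜ v = tv := ⟨_, rfl⟩
  obtain ⟨tw, htw'⟩ : ∃ tw, degIn D Sᶜ w = tw := ⟨_, rfl⟩
  obtain ⟨q, hq'⟩ : ∃ q, Q.card = q := ⟨_, rfl⟩
  obtain ⟨m, hm'⟩ : ∃ m, D.edgeFinset.card = m := ⟨_, rfl⟩
  obtain ⟨σ, hσ'⟩ : ∃ σ, ∑ x ∈ S, degIn D Sᶜ x * degIn D Sᶜ x = σ := ⟨_, rfl⟩
  obtain ⟨sR, hsR'⟩ : ∃ sR, ∑ y ∈ Sᶜ \ P, degIn D P y = sR := ⟨_, rfl⟩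
  obtain ⟨sY, hsY'⟩ : ∃ sY, ∑ y ∈ (Sᶜ \ P) \ Q, degIn D P y = sY := ⟨_, rfl⟩
  obtain ⟨sQ, hsQ'⟩ : ∃ sQ, ∑ z ∈ Q, degIn D P z = sQ := ⟨_, rfl⟩
  obtain ⟨qR, hqR'⟩ : ∃ qR, ∑ y ∈ Sᶜ \ P, degIn D (Sᶜ \ P) y = qR := ⟨_, rfl⟩
  obtain ⟨dQ, hdQ'⟩ : ∃ dQ, ∑ z ∈ Q, degIn D (Sᶜ \ P) z = dQ := ⟨_, rfl⟩
  obtain ⟨Dout, hDout'⟩ : ∃ Dout, ∑ z ∈ Q, degIn D Sᶜ z = Dout := ⟨_, rfl⟩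
  obtain ⟨C, hC'⟩ : ∃ C, ∑ y ∈ Sᶜ \ P, degIn D P y * degIn D P y = C := ⟨_, rfl⟩
  obtain ⟨r, hr'⟩ : ∃ r, ((Sᶜ \ P) \ Q).card = r := ⟨_, rfl⟩
  obtain ⟨Rc, hRc'⟩ : ∃ Rc, (Sᶜ \ P).card = Rc := ⟨_, rfl⟩
  rw [hn'] at hn hsum_s hRcard
  rw [ht'] at ht hmv hmw
  rw [htv'] at hmv hp hσ
  rw [htw'] at hmw hp hσ
  rw [ht'] at hp hσ
  rw [hq'] at hsum_s hYcard houter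
  rw [hm'] at hdens hm
  rw [hσ'] at hσ
  rw [hsR'] at hsplitR hsR
  rw [hsY', hsQ'] at hsR
  rw [hsY', hr', ht] at hsY
  rw [hsQ', hdQ', hDout'] at hDout
  rw [hqR', hdQ', hr'] at hdQ
  rw [hDout'] at houter
  rw [hqR'] at hsplitR
  rw [hBeq, hC', hsR', ht] at hBC
  rw [hr', hRc'] at hYcard
  rw [hRc'] at hRcard
  rw [hsR', hRc', ht] at hsRall
  rw [hqR', hRc'] at hqRall
  rw [hn', hσ', hq', hm', hsR', hDout', hC', ht]
  rw [hcomm] at hp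
  have hp' : n = t + tv + tw + q := by omega
  clear hp
  -- the facts, in numbers:
  -- hn : k = n + 3; hp : n − q = t + tv + tw; hσ : σ ≤ t² + (tv + tw)²; hdens : 2m = 6 + 2(n − q) + 2 sR + qR;
  -- hsR : sR = sY + sQ; hsY : sY ≤ r t; hDout : Dout = sQ + dQ; hdQ : qR ≤ 2 dQ + r (r − 1); houter : 2q ≤ Dout;
  -- hBC : C ≤ sR t; hRcard : Rc + t = n; hYcard : r + q = Rc; hmv, hmw : tv, tw ≤ t; hm : m = 41; hk : n + 3 = 14;
  -- hsRall : sR ≤ Rc t; hqRall : qR ≤ Rc (Rc − 1)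
  rw [hn] at hk
  have hk10 : 10 ≤ n := by omega
  have hr : r = tv + tw := by omega
  subst hr
  have hRc : Rc = tv + tw + q := by omega
  subst hRc
  subst hp'
  subst hm
  have hq0 : q = 0 := by omega
  subst hq0
  have hn11 : t + tv + tw + 0 = 11 := by omega
  have hQe : Q = ∅ := card_eq_zero.mp hq'
  have hsQ0 : sQ = 0 := by rw [← hsQ', hQe, sum_empty]
  have hdQ0 : dQ = 0 := by rw [← hdQ', hQe, sum_empty]
  have hDout0 : Dout = 0 := by rw [← hDout', hQe, sum_empty]
  have hYR : (Sᶜ \ P) \ Q = Sᶜ \ P := by rw [hQe, sdiff_empty]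
  have hsRle : sR ≤ (tv + tw) * t := by
    have e : tv + tw + 0 = tv + tw := by omega
    rw [e] at hsRall
    exact hsRall
  have hqRle : qR ≤ (tv + tw) * (tv + tw - 1) := by
    have e : tv + tw + 0 = tv + tw := by omega
    rw [e] at hqRall
    exact hqRall
  rw [hDout0]
  rcases Nat.lt_or_ge (tv + tw) 3 with hr2 | hr3
  · -- `r ≤ 2`: not dense
    exfalso
    interval_cases hvtw : (tv + tw) <;> omega
  rcases Nat.lt_or_ge (tv + tw) 4 with hr3' | hr4
  · -- `r = 3`, `t = 8`: impossible
    exfalso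
    have ht8 : t = 8 := by omega
    have hr3e : tv + tw = 3 := by omega
    subst ht8
    rw [hr3e] at hsRle hqRle
    have hdens2 : 2 * sR + qR = 54 := by omega
    rcases Nat.eq_zero_or_pos qR with hqR0 | hqRpos
    · omega
    · -- an adjacent pair in `R`
      obtain ⟨y, hy, hypos⟩ : ∃ y ∈ Sᶜ \ P, degIn D (Sᶜ \ P) y ≠ 0 := by
        by_contra hcon
        push Not at hcon
        have := sum_eq_zero hcon
        rw [hqR'] at this
        omega
      obtain ⟨y', hy'⟩ := card_pos.mp (Nat.pos_of_ne_zero hypos)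
      rw [mem_filter] at hy'
      have hne : y ≠ y' := fun h => D.irrefl (h ▸ hy'.2)
      have hpair := degIn_add_degIn_le_of_adj D S P hPS hnotri (sdiff_subset hy) (sdiff_subset hy'.1) hy'.2
      rw [ht] at hpair
      have hsub : ({y, y'} : Finset V) ⊆ Sᶜ \ P := by
        intro z hz
        rw [mem_insert, mem_singleton] at hz
        rcases hz with rfl | rfl
        · exact hy
        · exact hy'.1
      have hsplit := sum_sdiff (f := fun z => degIn D P z) hsub
      rw [sum_pair hne, hsR'] at hsplit
      have hrest := sum_degIn_le_card_mul D P ((Sᶜ \ P) \ {y, y'})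
      rw [card_sdiff_of_subset hsub, card_pair hne, hRc', ht] at hrest
      have e : tv + tw + 0 - 2 = 1 := by omega
      rw [e] at hrest
      omega
  · -- `r ≥ 4`, `t ≤ 7`: `σ ≤ 65`
    have ht7 : t ≤ 7 := by omega
    have ht4 : 4 ≤ t := by omega
    clear hsR' hsY' hsQ' hqR' hdQ' hDout' hC' hn' ht' htv' htw' hq' hσ' hr' hRc' hsplitR hdens hsR hsY
      hDout hdQ houter hBeq hYcard hRcard hsum_s hcomm hnotri hone hPind hPS hQR hQe hsQ0 hdQ0
      hYR hq hT hdeg hK hcl h3 hS hP hQ huv huw hvw hk hn hk10 hsRall hqRall hDout0 hr3 hr4 hsRle hqRle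
      hnoadjV hnoadjW
    have htv7 : tv ≤ 7 := by omega
    have htw7 : tw ≤ 7 := by omega
    interval_cases t <;> interval_cases tv <;> interval_cases tw <;> omega

/-- **THE `r = 4` STABILITY AT `(14, 41)`:** `K₄⁻`-free on 14 vertices with 41 edges ⇒ `Σ_v d(v)² + 36 ≤ 574`. -/
theorem dense_stability_four_fourteen_fortyone (D : SimpleGraph V) [DecidableRel D.Adj] (hK : K4mFree D)
    (hk : Fintype.card V = 14) (hm : D.edgeFinset.card = 41) :
    ∑ v, deg D v * deg D v + 4 * (Fintype.card V - 5) ≤ D.edgeFinset.card * Fintype.card V := by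
  apply dense_stability_four_modulo_few_outer D hK (by omega) (by omega) (by
    rw [hk, hm]
    exact products_avoid 14 5 (by norm_num) (by norm_num))
  intro u v w huv huw hvw hT hdeg hpay _
  exact residue_of_largest D 0
    (fun u v w huv huw hvw hT hmv hmw hq =>
      one_triangle_residue_fourteen D hK huv huw hvw hT hk hdeg hmv hmw hm hq)
    huv huw hvw hT (by omega)

/-- **THE CELL `(14, 41)`:** the maximum of `2·Σ_v C(d(v), 2)` over the `K₄⁻`-free graphs on `Fin 14` with `41`
edges is `41 · 12 − 36 = 456`, attained by `K_{5, 9}` minus four edges at one vertex. -/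
theorem four_below_diagonal_exact_k4m_fourteen_fortyone :
    (∀ (D : SimpleGraph (Fin 14)) [DecidableRel D.Adj], K4mFree D → D.edgeFinset.card = 41 →
        2 * cherries D + 36 ≤ 492) ∧
      ∃ (D : SimpleGraph (Fin 14)) (_ : DecidableRel D.Adj), K4mFree D ∧
        D.edgeFinset.card = 41 ∧ 2 * cherries D + 36 = 492 := by
  have h := four_below_diagonal_exact_k4m_of_thirteen_modulo 14 5 (by norm_num) (by norm_num) (by norm_num)
    (by norm_num) (products_avoid 14 5 (by norm_num) (by norm_num)) (by
      intro D _ hK hD u v w huv huw hvw hT hdeg hpay _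
      have hcard : Fintype.card (Fin 14) = 14 := Fintype.card_fin 14
      have := residue_of_largest D 0
        (fun u v w huv huw hvw hT hmv hmw hq =>
          one_triangle_residue_fourteen D hK huv huw hvw hT hcard hdeg hmv hmw (by rw [hD]) hq)
        huv huw hvw hT (by rw [hD] at hpay; omega)
      rwa [hcard] at this)
  norm_num at h
  exact h

/-- **FOUR BELOW THE DIAGONAL IS EXACT ON THE `K₄⁻`-FREE CLASS ON EVERY CELL `k ≥ 13`, `3 ≤ a`, `2a + 4 ≤ k`:**
the maximum of `2·Σ_v C(d(v), 2)` over the `K₄⁻`-free graphs on `Fin k` with `a (k − a) − 4` edges is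
`(a (k − a) − 4)(k − 2) − 4 (k − 5)`, attained by `K_{a, k−a}` minus four edges at one vertex.  (`2a + 4 ≤ k` is
exactly the condition under which the four numbers `a (k − a) − 4, …, a (k − a) − 1` are not products
`a′ (k − a′)`, i.e. the cell lies on the sub-diagonal `r = 4` of the closed form.) -/
theorem four_below_diagonal_exact_k4m_all (k a : ℕ) (hk : 13 ≤ k) (ha : 3 ≤ a) (hak : 2 * a + 4 ≤ k) :
    (∀ (D : SimpleGraph (Fin k)) [DecidableRel D.Adj], K4mFree D →
        D.edgeFinset.card = a * (k - a) - 4 →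
        2 * cherries D + 4 * (k - 5) ≤ (a * (k - a) - 4) * (k - 2)) ∧
      ∃ (D : SimpleGraph (Fin k)) (_ : DecidableRel D.Adj), K4mFree D ∧
        D.edgeFinset.card = a * (k - a) - 4 ∧ 2 * cherries D + 4 * (k - 5) = (a * (k - a) - 4) * (k - 2) := by
  rcases Nat.lt_or_ge a 6 with h6 | h6
  · interval_cases a
    · exact four_below_diagonal_exact_k4m_three_all k hk
    · exact four_below_diagonal_exact_k4m_four_all k hk
    · rcases Nat.lt_or_ge k 15 with h15 | h15
      · have hk14 : k = 14 := by omega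
        subst hk14
        have h := four_below_diagonal_exact_k4m_fourteen_fortyone
        norm_num
        exact h
      · exact four_below_diagonal_exact_k4m_of_five k h15
  · exact four_below_diagonal_exact_k4m_of_six k a hk h6 hak

end C047

end TriangleCap

end PercRepro
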